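import Summits.AnomalousDissipation.AnomalousDissipation.Theses.FrictionOrderLadder
import Literature.Analysis.FunctionSpaces.TorusTrigPoly

/-!
# Crux `CleanRoomInjectionFloor` (stmt-AnomalousDissipation-2932, route FrictionOrderLadder, rank 2) — line `flux`

Alternative line registered by the crux-strategist (planner-cstrat-stmt-AnomalousDissipation-2932-s1-0,
2026-08-17). It does NOT replace the live skeleton `Lines/birth.lean`: the composing theorem below uses
birth's registered stub `stub_cleanRoomWellPosed` VERBATIM (shared obligation) and two NEW stubs
(`stub_lowPassBudget`, `stub_fluxFloor`) registered on the item with `ledger workitem stub-add`.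

## The cut: EXISTENCE (shared) ∣ LOW-PASS BUDGET (provable) ∣ A-PRIORI FLUX FLOOR AT A FIXED SCALE (the residue)

Birth floors the running mean of the TOTAL FRICTION DISSIPATION `ν‖∇u‖² + μ∫⟪u, Δ²u⟫`, a quantity that
lives at the dissipation scale `k_d(ν, μ) → ∞`. This line floors instead the running mean of the FORWARD
ENERGY FLUX through ONE FIXED wavenumber `N` (the force being band-limited, `P_N f = f`):

  `Π_N(v) := −∫ ⟪v, (v·∇)(P_N v)⟫`  (`P_N = Torus.fourierTruncate N`; for smooth divergence-free `v`
  this is `∫ ⟪(v·∇)v, P_N v⟫`, the nonlinear transfer out of the modes `|k| ≤ N`; Frisch 1995 §6.2 `Π_K`).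

For a CLASSICAL clean-room solution the low-pass energy budget is an exact identity (pair the momentum
equation with the trigonometric polynomial `P_N u`; pressure drops by `isDivFree_fourierTruncate`):

  `d/dt ½‖P_N u‖² = −Π_N(u) − ν‖∇P_N u‖² − μ∫⟪P_N u, Δ² P_N u⟫ + ∫⟪f, u⟫`     (`P_N f = f`),

so `timeMean Π_N ≤ timeMean ⟪f,u⟫ + KE(u 0)/T` (drop the two non-negative low-mode friction terms and
`KE(P_N u T) ≥ 0`, Bessel `KE(P_N u 0) ≤ KE(u 0)`). Hence an a-priori FLUX floor `δ` through `N`, uniform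
in `j` and in `μ ∈ (0, μ₀]`, gives the crux's injection floor `ε := δ/2` for `T ≥ 2K/δ`, with NO friction
term to control: `Π_N` contains neither `ν` nor `μ`. This is Kolmogorov's constant-flux statement at one
inertial wavenumber (the 4/5-law object), in the solution class where the scale-by-scale budget is exact
(no Duchon–Robert defect, no choice of weak solution).

* `stub_cleanRoomWellPosed` — birth's stub 1 verbatim (global classical well-posedness of Lions' clean room
  on `T³`, `ν, μ > 0`; BeiraoDaVeiga1985 = LemarieRieusset2016 Thm 18.5; known, size L). SHARED.
* `stub_lowPassBudget` (known-type, provable now; size M/L): for `ν, μ ≥ 0`, smooth band-limited `f`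
  (`P_N f = f`) and every classical clean-room solution on `[0, ∞)`, for every `T > 0`:
  `timeMean (Π_N ∘ u) T ≤ timeMean ⟪f, u⟫ T + kineticEnergy (u 0) / T`.
* `stub_fluxFloor` (the residue; open, zeroth-law class; size XL): ∃ smooth divergence-free mean-zero
  band-limited `f` (`P_N f = f`), `ν_j → 0⁺`, admissible data `u₀ j` with `KE ≤ K`, `μ₀, δ > 0`, `E`, `T₀`:
  for every `j`, every `μ ∈ (0, μ₀]` and EVERY classical clean-room solution from `u₀ j`, for `T ≥ T₀`:
  running-mean energy `≤ E` and running-mean flux `timeMean (Π_N ∘ u) T ≥ δ`.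

Composition `CleanRoomInjectionFloor_of` (no sorry): witnesses of stub 3; `ε := δ/2`,
`T₀' := max T₀ (max 1 (2K/δ))`; the solution for `(j, μ)` is stub 1's; energy clause verbatim; injection
`≥ flux − KE(u 0)/T ≥ δ − K/T ≥ δ/2`.

Positioning (paper proof in `STRATEGY-CENSUS.md` §Strengthen S2, same directory): `stub_fluxFloor ∧ stub_lowPassBudget`
⇒ the a-priori INJECTION floor (∀ solutions from the data, `timeMean ⟪f,u⟫ ≥ δ − K/T`; this is the body of the
composition below) and, with birth's `stub_cleanRoomBudget` plus an endpoint-energy averaging (`T' ∈ [¾T, T]` with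
`KE(u T') ≤ 2E`, cumulative dissipation monotone), ⇒ birth's `stub_aprioriFrictionFloor` with `δ/2` and
`T₀ ∨ 4(K+2E)/δ`: the flux heart is a STRENGTHENING of birth's heart, not a rewording; the converse fails at `μ`
comparable to `μ₀` (injection may be carried by low-mode hyperviscous friction rather than by flux), which is why
`μ₀` is part of the witness.

Disproof used: none relevant (no `Disproof.lean` for this crux at registration). Negatives honoured: the two
Galilean-drift refutations (stmt-2979, stmt-0204) — data are MEAN-ZERO and the energy ceiling is claimed only
for their solutions; TaylorCertificatePair (stmt-13037) — the floor is trajectory-wise (time averages), not a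
state-wise certificate; KolmogorovFloor/Negative `not_floor_*` and CubicParityLoud/Negative/FluxFloor concern
STATE-wise flux floors over energy/enstrophy balls — not instances (see the card `Lines/flux.md`).
-/

-- `Summit.<Summit>.<Problem>`: single-conjunct summit, the duplicate component is the tree's convention.
set_option linter.dupNamespace false

noncomputable section

open Filter Set MeasureTheory Topology

namespace Summit.AnomalousDissipation.AnomalousDissipation.Cruxes.CleanRoomInjectionFloor.Flux

/-- **stub 1 — GLOBAL CLASSICAL WELL-POSEDNESS OF LIONS' CLEAN ROOM ON `T³`** — birth's registered stub,
VERBATIM (shared obligation; see `Lines/birth.lean` for the docstring). Known (BeiraoDaVeiga1985 =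
LemarieRieusset2016 §18.3 Thm 18.5; Lions1969 Rem 6.11; Temam1997 VIII (4.6)); size L. -/
theorem stub_cleanRoomWellPosed :
    ∀ (ν μ : ℝ) (f u₀ : UnitAddTorus (Fin 3) → EuclideanSpace ℝ (Fin 3)), 0 < ν → 0 < μ → Literature.Analysis.FunctionSpaces.Torus.IsSmooth f → Literature.Analysis.FunctionSpaces.Torus.IsDivFree f → Literature.Analysis.FunctionSpaces.Torus.HasZeroMean f → Literature.Analysis.FunctionSpaces.Torus.IsSmooth u₀ → Literature.Analysis.FunctionSpaces.Torus.IsDivFree u₀ → Literature.Analysis.FunctionSpaces.Torus.HasZeroMean u₀ → ∃ (u : ℝ → UnitAddTorus (Fin 3) → EuclideanSpace ℝ (Fin 3)) (p : ℝ → UnitAddTorus (Fin 3) → ℝ), Literature.Analysis.FunctionSpaces.Torus.IsClassicalNSSolutionOn (Set.Ici 0) ν (fun t x => f x - μ • Literature.Analysis.FluidPDE.Torus.fracLaplacian (2 : ℝ) (u t) x) u p ∧ u 0 = u₀ := by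
  sorry

/-- **stub 2 — THE LOW-PASS ENERGY BUDGET OF A CLASSICAL CLEAN-ROOM SOLUTION (known-type, provable now;
size M/L).** For `ν, μ ≥ 0`, a smooth force band-limited at wavenumber `N` (`P_N f = f`) and every
classical solution `(u, p)` on `[0, ∞)` of `∂ₜu + (u·∇)u + ∇p = νΔu − μΔ²u + f`, for every `T > 0`:
the running mean of the forward flux `Π_N(u t) = −∫⟪u t, (u t·∇)(P_N (u t))⟫` is at most the running
mean of the injection `∫⟪f, u t⟫` plus `kineticEnergy (u 0) / T`.
Why true: pair the momentum equation (pointwise, `IsClassicalNSSolutionOn.momentum`) with the real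
trigonometric polynomial `P_N (u t)` and integrate over `T³`: `∂ₜ` gives `d/dt ½‖P_N u‖²` (finitely many
Fourier coefficients, each `C¹` in `t` by joint smoothness; one-sided derivative within `Ici 0`);
`∫⟪(u·∇)u, P_N u⟫ = Π_N(u)` (integration by parts, `div u = 0`); the pressure pairs to `0`
(`isDivFree_fourierTruncate`); `ν∫⟪Δu, P_N u⟫ = −ν‖∇P_N u‖² ≤ 0` and `−μ∫⟪Δ²u, P_N u⟫ = −μ∫⟪P_N u, Δ²P_N u⟫ ≤ 0`
(Fourier multipliers commute with `P_N`; `integral_inner_self_fracLaplacian_nonneg`); `∫⟪f, P_N u⟫ = ∫⟪P_N f, u⟫ = ∫⟪f, u⟫`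
(`integral_inner_fourierTruncate_fourierTruncate`). Integrate over `[0, T]` (one-sided FTC,
`intervalIntegral.integral_eq_sub_of_hasDeriv_right_of_le`), drop the two non-positive friction integrals and
`−KE(P_N u T) ≤ 0`, bound `KE(P_N (u 0)) ≤ KE(u 0)` (Bessel, `integral_norm_sq_fourierTruncate`), divide by `T`.
Why it might fail: it should not (if `t ↦ Π_N(u t)` were not interval-integrable the left side is the junk `0`
and the inequality still holds by the plain energy budget; for classical solutions it is continuous).
Sources: Frisch1995 §6.2; DoeringFoias2002 §2; ConstantinFoias1988 (8.3). -/
theorem stub_lowPassBudget :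
    ∀ (ν μ : ℝ) (N : ℕ) (f : UnitAddTorus (Fin 3) → EuclideanSpace ℝ (Fin 3)) (u : ℝ → UnitAddTorus (Fin 3) → EuclideanSpace ℝ (Fin 3)) (p : ℝ → UnitAddTorus (Fin 3) → ℝ), 0 ≤ ν → 0 ≤ μ → Literature.Analysis.FunctionSpaces.Torus.IsSmooth f → Literature.Analysis.FunctionSpaces.Torus.fourierTruncate N f = f → Literature.Analysis.FunctionSpaces.Torus.IsClassicalNSSolutionOn (Set.Ici 0) ν (fun t x => f x - μ • Literature.Analysis.FluidPDE.Torus.fracLaplacian (2 : ℝ) (u t) x) u p → ∀ T : ℝ, 0 < T → Literature.Analysis.FluidPDE.timeMean (fun t => - MeasureTheory.integral MeasureTheory.volume (fun x => inner ℝ (u t x) (Literature.Analysis.FunctionSpaces.Torus.convect (u t) (Literature.Analysis.FunctionSpaces.Torus.fourierTruncate N (u t)) x))) T ≤ Literature.Analysis.FluidPDE.timeMean (fun t => MeasureTheory.integral MeasureTheory.volume (fun x => inner ℝ (f x) (u t x))) T + Literature.Analysis.FunctionSpaces.Torus.kineticEnergy (u 0) / T := by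
  sorry

/-- **stub 3 — A-PRIORI FLUX FLOOR THROUGH A FIXED WAVENUMBER (the residue of the crux on this line;
open, zeroth-law class; size XL).** There are a smooth divergence-free mean-zero force `f` on `T³`,
band-limited at some wavenumber `N` (`P_N f = f`), viscosities `ν_j > 0`, `ν_j → 0`, smooth divergence-free
mean-zero data `u₀ j` with `kineticEnergy (u₀ j) ≤ K`, and constants `μ₀, δ > 0`, `E`, `T₀` such that for
every `j`, every hyperviscosity `μ ∈ (0, μ₀]` and EVERY global classical solution `(u, p)` of the clean-room
system `∂ₜu + (u·∇)u + ∇p = ν_jΔu − μΔ²u + f` with `u 0 = u₀ j`, for all `T ≥ T₀`: the running-mean energy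
`T⁻¹∫₀ᵀ‖u‖₂² ≤ E` and the running-mean FORWARD FLUX through `N`, `T⁻¹∫₀ᵀ Π_N(u t) dt ≥ δ`.
This is Kolmogorov's constant-flux law at ONE wavenumber just above the forcing band, in a-priori form
(all solutions from the chosen data — unique for `μ > 0`, so nothing is lost) and uniformly in the two
friction parameters, which do not enter the functional `Π_N` at all: the claim is that the large scales
`|k| ≤ N` keep exporting energy at rate `≥ δ` whatever absorbs it downstream (viscosity, hyperviscosity, or
both). `μ₀` is part of the witness: for `μ` large the injection is eaten by low-mode hyperviscous friction and
the flux through `N` may vanish, so the prover takes `μ₀` (and `ν_j`) small enough that the dissipation range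
starts above `N`. Why it might fail: it implies the crux (hence is at least zeroth-law hard) — no friction-uniform
flux or dissipation floor is known for ANY deterministic steady force (DoeringFoias2002 §3: only the energy floor
`U² ≳ Fℓ` is uniform, dissipation/injection floors are `∝ ν`; ChildressKerswellGilbert2001: variational bounds for
Kolmogorov forcing, no friction-uniform floor; Cheskidov2023 p.4; BrueDeLellis2023 Q2.1–2.2 open); the only solved deterministic
sibling with steady forcing (dyadic model, CheskidovFriedlander2009) uses a SIGN-DEFINITE flux, which `Π_N` is
not (backscatter); planar / shear / gravest-mode forces give vanishing or negative mean flux at bounded energy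
(AlexakisDoering2006, Marchioro1986), so `f` must be genuinely three-dimensional; transients threaten a uniform `T₀`.
Sources: Frisch1995 §6.2, DoeringFoias2002, Cheskidov2023, BrueDeLellis2023, CheskidovFriedlander2009,
BorueOrszag1996, KanedaEtAl2003, DuchonRobert2000. -/
theorem stub_fluxFloor :
    ∃ f : UnitAddTorus (Fin 3) → EuclideanSpace ℝ (Fin 3), Literature.Analysis.FunctionSpaces.Torus.IsSmooth f ∧ Literature.Analysis.FunctionSpaces.Torus.IsDivFree f ∧ Literature.Analysis.FunctionSpaces.Torus.HasZeroMean f ∧ ∃ N : ℕ, Literature.Analysis.FunctionSpaces.Torus.fourierTruncate N f = f ∧ ∃ (ν : ℕ → ℝ) (u₀ : ℕ → UnitAddTorus (Fin 3) → EuclideanSpace ℝ (Fin 3)), (∀ j, 0 < ν j) ∧ Filter.Tendsto ν Filter.atTop (nhds 0) ∧ (∀ j, Literature.Analysis.FunctionSpaces.Torus.IsSmooth (u₀ j) ∧ Literature.Analysis.FunctionSpaces.Torus.IsDivFree (u₀ j) ∧ Literature.Analysis.FunctionSpaces.Torus.HasZeroMean (u₀ j)) ∧ ∃ μ₀ K E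 δ T₀ : ℝ, 0 < μ₀ ∧ 0 < δ ∧ (∀ j, Literature.Analysis.FunctionSpaces.Torus.kineticEnergy (u₀ j) ≤ K) ∧ ∀ (j : ℕ) (μ : ℝ), 0 < μ → μ ≤ μ₀ → ∀ (u : ℝ → UnitAddTorus (Fin 3) → EuclideanSpace ℝ (Fin 3)) (p : ℝ → UnitAddTorus (Fin 3) → ℝ), Literature.Analysis.FunctionSpaces.Torus.IsClassicalNSSolutionOn (Set.Ici 0) (ν j) (fun t x => f x - μ • Literature.Analysis.FluidPDE.Torus.fracLaplacian (2 : ℝ) (u t) x) u p → u 0 = u₀ j → ∀ T : ℝ, T₀ ≤ T → Literature.Analysis.FluidPDE.timeMean (fun t => MeasureTheory.integral MeasureTheory.volume (fun x => ‖u t x‖ ^ 2)) T ≤ E ∧ δ ≤ Literature.Analysis.FluidPDE.timeMean (fun t => - MeasureTheory.integral MeasureTheory.volume (fun x => inner ℝ (u t x) (Literature.Analysis.FunctionSpaces.Torus.convect (u t) (Literature.Analysis.FunctionSpaces.Torus.fourierTruncate N (u t)) x))) T := by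
  sorry

/-! ## Name-keyed aliases of the three stub statements — the hypotheses of `CleanRoomInjectionFloor_of`

(`__Registered.stub_X` is the statement of `stub_X` verbatim under the stub's short name, the device of
`Lines/birth.lean`; `stub_cleanRoomWellPosed` is birth's registered stub, character for character.) -/
namespace __Registered

/-- Alias of the statement of `stub_cleanRoomWellPosed` (birth's stub 1, shared), keyed by the stub name. -/
abbrev stub_cleanRoomWellPosed : Prop :=
  ∀ (ν μ : ℝ) (f u₀ : UnitAddTorus (Fin 3) → EuclideanSpace ℝ (Fin 3)), 0 < ν → 0 < μ → Literature.Analysis.FunctionSpaces.Torus.IsSmooth f → Literature.Analysis.FunctionSpaces.Torus.IsDivFree f → Literature.Analysis.FunctionSpaces.Torus.HasZeroMean f → Literature.Analysis.FunctionSpaces.Torus.IsSmooth u₀ → Literature.Analysis.FunctionSpaces.Torus.IsDivFree u₀ → Literature.Analysis.FunctionSpaces.Torus.HasZeroMean u₀ → ∃ (u : ℝ → UnitAddTorus (Fin 3) → EuclideanSpace ℝ (Fin 3)) (p : ℝ → UnitAddTorus (Fin 3) → ℝ), Literature.Analysis.FunctionSpaces.Torus.IsClassicalNSSolutionOn (Set.Ici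 0) ν (fun t x => f x - μ • Literature.Analysis.FluidPDE.Torus.fracLaplacian (2 : ℝ) (u t) x) u p ∧ u 0 = u₀

/-- Alias of the statement of `stub_lowPassBudget` (low-pass energy budget), keyed by the stub name. -/
abbrev stub_lowPassBudget : Prop :=
  ∀ (ν μ : ℝ) (N : ℕ) (f : UnitAddTorus (Fin 3) → EuclideanSpace ℝ (Fin 3)) (u : ℝ → UnitAddTorus (Fin 3) → EuclideanSpace ℝ (Fin 3)) (p : ℝ → UnitAddTorus (Fin 3) → ℝ), 0 ≤ ν → 0 ≤ μ → Literature.Analysis.FunctionSpaces.Torus.IsSmooth f → Literature.Analysis.FunctionSpaces.Torus.fourierTruncate N f = f → Literature.Analysis.FunctionSpaces.Torus.IsClassicalNSSolutionOn (Set.Ici 0) ν (fun t x => f x - μ • Literature.Analysis.FluidPDE.Torus.fracLaplacian (2 : ℝ) (u t) x) u p → ∀ T : ℝ, 0 < T → Literature.Analysis.FluidPDE.timeMean (fun t => - MeasureTheory.integral MeasureTheory.volume (fun x => inner ℝ (u t x) (Literature.Analysis.FunctionSpaces.Torus.convect (u t) (Literature.Analysis.FunctionSpaces.Torus.fourierTruncate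 N (u t)) x))) T ≤ Literature.Analysis.FluidPDE.timeMean (fun t => MeasureTheory.integral MeasureTheory.volume (fun x => inner ℝ (f x) (u t x))) T + Literature.Analysis.FunctionSpaces.Torus.kineticEnergy (u 0) / T

/-- Alias of the statement of `stub_fluxFloor` (a-priori flux floor through a fixed wavenumber), keyed by the stub name. -/
abbrev stub_fluxFloor : Prop :=
  ∃ f : UnitAddTorus (Fin 3) → EuclideanSpace ℝ (Fin 3), Literature.Analysis.FunctionSpaces.Torus.IsSmooth f ∧ Literature.Analysis.FunctionSpaces.Torus.IsDivFree f ∧ Literature.Analysis.FunctionSpaces.Torus.HasZeroMean f ∧ ∃ N : ℕ, Literature.Analysis.FunctionSpaces.Torus.fourierTruncate N f = f ∧ ∃ (ν : ℕ → ℝ) (u₀ : ℕ → UnitAddTorus (Fin 3) → EuclideanSpace ℝ (Fin 3)), (∀ j, 0 < ν j) ∧ Filter.Tendsto ν Filter.atTop (nhds 0) ∧ (∀ j, Literature.Analysis.FunctionSpaces.Torus.IsSmooth (u₀ j) ∧ Literature.Analysis.FunctionSpaces.Torus.IsDivFree (u₀ j) ∧ Literature.Analysis.FunctionSpaces.Torus.HasZeroMean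 (u₀ j)) ∧ ∃ μ₀ K E δ T₀ : ℝ, 0 < μ₀ ∧ 0 < δ ∧ (∀ j, Literature.Analysis.FunctionSpaces.Torus.kineticEnergy (u₀ j) ≤ K) ∧ ∀ (j : ℕ) (μ : ℝ), 0 < μ → μ ≤ μ₀ → ∀ (u : ℝ → UnitAddTorus (Fin 3) → EuclideanSpace ℝ (Fin 3)) (p : ℝ → UnitAddTorus (Fin 3) → ℝ), Literature.Analysis.FunctionSpaces.Torus.IsClassicalNSSolutionOn (Set.Ici 0) (ν j) (fun t x => f x - μ • Literature.Analysis.FluidPDE.Torus.fracLaplacian (2 : ℝ) (u t) x) u p → u 0 = u₀ j → ∀ T : ℝ, T₀ ≤ T → Literature.Analysis.FluidPDE.timeMean (fun t => MeasureTheory.integral MeasureTheory.volume (fun x => ‖u t x‖ ^ 2)) T ≤ E ∧ δ ≤ Literature.Analysis.FluidPDE.timeMean (fun t => - MeasureTheory.integral MeasureTheory.volume (fun x => inner ℝ (u t x) (Literature.Analysis.FunctionSpaces.Torus.convect (u t) (Literature.Analysis.FunctionSpaces.Torus.fourierTruncate N (u t)) x))) T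

end __Registered

/-- **Composition** (kernel-checked, no `sorry` of its own): the three stub statements (as the
name-keyed aliases `__Registered.stub_*`) imply the crux
`Summit.AnomalousDissipation.AnomalousDissipation.Theses.FrictionOrderLadder.CleanRoomInjectionFloor` BY
NAME. Witnesses: stub 3's `f, ν, u₀, μ₀, E`, with `ε := δ/2` and `T₀' := max T₀ (max 1 (2K/δ))`; the
solution for `(j, μ)` is stub 1's; the injection floor is stub 3's flux floor moved through the low-pass
budget of stub 2, the initial-energy term being `≤ K/T ≤ δ/2` for `T ≥ 2K/δ`. [bookkeeping] -/
theorem CleanRoomInjectionFloor_of :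
    __Registered.stub_cleanRoomWellPosed → __Registered.stub_lowPassBudget →
      __Registered.stub_fluxFloor →
        Summit.AnomalousDissipation.AnomalousDissipation.Theses.FrictionOrderLadder.CleanRoomInjectionFloor := by
  intro hWP hB hF
  dsimp only [__Registered.stub_cleanRoomWellPosed, __Registered.stub_lowPassBudget,
    __Registered.stub_fluxFloor] at hWP hB hF
  obtain ⟨f, hf, hdf, hmf, N, hPN, ν, u₀, hν, hν0, hu₀, μ₀, K, E, δ, T₀, hμ₀, hδ, hK, H⟩ := hF
  unfold Summit.AnomalousDissipation.AnomalousDissipation.Theses.FrictionOrderLadder.CleanRoomInjectionFloor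
  refine ⟨f, hf, hdf, hmf, ν, u₀, hν, hν0, hu₀, μ₀, E, δ / 2, max T₀ (max 1 (2 * K / δ)), hμ₀,
    half_pos hδ, ?_⟩
  intro j μ hμ hμle
  -- the solution: stub 1 (global classical well-posedness of the clean room)
  obtain ⟨u, p, hsol, hu0⟩ :=
    hWP (ν j) μ f (u₀ j) (hν j) hμ hf hdf hmf (hu₀ j).1 (hu₀ j).2.1 (hu₀ j).2.2
  refine ⟨u, p, hsol, hu0, ?_⟩
  intro T hT
  have hT₀ : T₀ ≤ T := le_trans (le_max_left _ _) hT
  have hT1 : (1 : ℝ) ≤ T := le_trans (le_trans (le_max_left _ _) (le_max_right _ _)) hT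
  have hTK : 2 * K / δ ≤ T := le_trans (le_trans (le_max_right _ _) (le_max_right _ _)) hT
  have hTpos : 0 < T := lt_of_lt_of_le one_pos hT1
  -- the a-priori bounds: stub 3, for this solution
  obtain ⟨hE, hD⟩ := H j μ hμ hμle u p hsol hu0 T hT₀
  refine ⟨hE, ?_⟩
  -- flux ≤ injection + KE(u 0)/T: stub 2
  have hbud := hB (ν j) μ N f u p (hν j).le hμ.le hf hPN hsol T hTpos
  have hKE_0 : Literature.Analysis.FunctionSpaces.Torus.kineticEnergy (u 0) ≤ K := by
    rw [hu0]; exact hK j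
  have h2K : 2 * K ≤ T * δ := (div_le_iff₀ hδ).mp hTK
  have hdrop : Literature.Analysis.FunctionSpaces.Torus.kineticEnergy (u 0) / T ≤ δ / 2 := by
    rw [div_le_iff₀ hTpos]
    nlinarith [hKE_0, h2K, hTpos.le, hδ.le]
  linarith [hD, hbud, hdrop]

/-- WIRING CHECK: the three sorried stubs compose to a closed term of the crux's type (modulo their
`sorry`s). Deliberately an `example` (no constant enters the environment). -/
example : Summit.AnomalousDissipation.AnomalousDissipation.Theses.FrictionOrderLadder.CleanRoomInjectionFloor :=
  CleanRoomInjectionFloor_of stub_cleanRoomWellPosed stub_lowPassBudget stub_fluxFloor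

end Summit.AnomalousDissipation.AnomalousDissipation.Cruxes.CleanRoomInjectionFloor.Flux

end
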